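import Summits.ABC.IUTFork.Joshi.BundlingRings

/-!
# Thm. 7.7.3.1 at a FIXED `ρ` — the contentful form of the derived estimate (proof-only companion of `Joshi/BundlingRings.lean`)

Block E of the abc-iut cell (rung LADDER-ABC:A2.E; seat abc-iut-E-t13). K. Joshi, *Construction of Arithmetic Teichmüller Spaces III*,
arXiv:2401.13508v4 (UNREFEREED, disputed; `Joshi2024ATS3`), Thm. 7.7.3.1 p. 66–67. `BundlingRings.lean` (p429549) typed the size
`|S|_{B̆⊗} := sup_{ρ ∈ (0,1]} sup_{t ∈ S} |t|_ρ` by the Def. 7.2.7 recipe ((7.2.9), p. 54 l. 61–76) and DERIVED Thm. 7.7.3.1 from its two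
inputs THROUGH a fixed `ρ`. E-t12's flag `Joshi/FundamentalEstimateBLSizeFlag.lean` (p430788; print p. 57 l. 3–8 «`sup_{0<ρ<1}
|Φ|_{B_{L′},ρ}` is evidently bounded» conflates Fréchet-boundedness with boundedness UNIFORM in `ρ`; Frobenius eigen-components make
`|·|_ρ` unbounded as `ρ → 0⁺`) shows that in Fargues–Fontaine models the `(7.2.9)`-size of a locus can be `+∞`, so that an estimate
«`bound ≤ size`» may hold TRIVIALLY. This file records the NON-trivial content of the derivation in `BundlingRings.lean`: the SAME two
inputs give the estimate for the size AT THE FIXED `ρ` ((7.2.8), `sizeAt`), for every `ρ` at which they hold — which is how print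
states the inputs («for each `0 < ρ < 1` … one has the lower bound (7.7.3.3)», p. 67 l. 1–13; (7.7.3.2) at the same `ρ`). All PROVED
from the landed signature; nothing asserted; no side taken on [IUTchIII] Cor. 3.12, on Joshi's claims or on Mochizuki's reports;
typed ≠ proved ≠ endorsed. Standard axioms; sorry-free.
-/

noncomputable section

open Set

namespace Summit.ABC.IUTFork.Joshi.ATS3

namespace PrimeBundlingDatum

variable {lstar : ℕ} {Qp Bp : Type} [Field Qp] [CommRing Bp] [Algebra Qp Bp] {I : Type} [Fintype I] [DecidableEq I]
  {E BE : I → Type} [∀ w, Field (E w)] [∀ w, Algebra Qp (E w)] [∀ w, CommRing (BE w)] [∀ w, Algebra Qp (BE w)]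
  [∀ w, Algebra Bp (BE w)] {T : Type} [CommRing T] (D : PrimeBundlingDatum lstar Qp Bp I E BE T)

/-- **Thm. 7.7.3.1 at `p`, FIXED-`ρ` form, DERIVED**: the per-`w` pilot lower bound (7.7.3.3) at `ρ` and the cross-norm property
(7.7.3.2) at `ρ` give `∏_{w ∈ 𝕍^{odd,ss}_p} |q_w^{1/2ℓ}|^{ℓ⋇} ≤ |Θ̃^{B̆⊗}_{Joshi,p}|_{B̆⊗,ρ}` (the size (7.2.8) AT `ρ`), for EVERY real `ρ`
at which the inputs hold — no supremum over `ρ` involved. This is the contentful statement behind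
`localFundamentalEstimate_of_pilot_of_crossNorm` (whose `(7.2.9)`-form follows by `sizeAt ≤ size` for `ρ ∈ (0,1]`). [folklore] -/
theorem sizeAt_locusTensor_ge_of_pilot_of_crossNorm {ρ : ℝ} (hZ : D.PilotLowerBoundAt ρ) (hx : D.CrossNormAt ρ) :
    (((∏ w ∈ D.Vss, D.qRoot w ^ lstar : ℝ) : ℝ) : EReal) ≤ D.sizeAt D.locusTensor ρ := by
  obtain ⟨z, hzmem, hzle⟩ := D.exists_mem_locusBundled_of_pilot hZ
  have hprod : (∏ w ∈ D.Vss, D.qRoot w ^ lstar) ≤ D.tupleNormT ρ (D.tprodTuple z) := by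
    rw [D.tupleNormT_tprodTuple_eq hx z, ← Finset.prod_coe_sort D.Vss]
    exact Finset.prod_le_prod (fun w _ => pow_nonneg (D.qRoot_pos w.1 w.2).le _) fun w _ => hzle w
  exact (EReal.coe_le_coe_iff.2 hprod).trans (D.tupleNormT_le_sizeAt (Set.mem_image_of_mem _ hzmem) ρ)

end PrimeBundlingDatum

namespace PrimeBundlingFamily

variable {lstar : ℕ} {P : Type} {Qp Bp : P → Type} [∀ p, Field (Qp p)] [∀ p, CommRing (Bp p)] [∀ p, Algebra (Qp p) (Bp p)]
  {I : P → Type} [∀ p, Fintype (I p)] [∀ p, DecidableEq (I p)] {E BE : (p : P) → I p → Type} [∀ p w, Field (E p w)]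
  [∀ p w, Algebra (Qp p) (E p w)] [∀ p w, CommRing (BE p w)] [∀ p w, Algebra (Qp p) (BE p w)] [∀ p w, Algebra (Bp p) (BE p w)]
  {T : P → Type} [∀ p, CommRing (T p)] (A : PrimeBundlingFamily lstar P Qp Bp I E BE T)

/-- **Thm. 7.7.3.1 (adelic), FIXED-`ρ` form, DERIVED**: if at one real `ρ` every `p` of the support satisfies the per-`w` pilot lower
bound and the cross-norm property, then `∏_{p} ∏_{w ∈ 𝕍^{odd,ss}_p} |q_w^{1/2ℓ}|^{ℓ⋇} ≤ |Θ̃^{B̆⊗}_{Joshi}|_ρ` (the adelic size (7.2.8) AT `ρ`) —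
by the ONE exhibited member (7.7.3.4). No supremum over `ρ`; this is the non-trivial content of
`fundamentalEstimateTensor_of_pilot_of_crossNorm`. [folklore] -/
theorem sizeAt_adelicLocusTensor_ge {ρ : ℝ} (hZ : ∀ p : A.support, (A.loc p.1).PilotLowerBoundAt ρ)
    (hx : ∀ p : A.support, (A.loc p.1).CrossNormAt ρ) :
    (((∏ p : A.support, ∏ w ∈ (A.loc p.1).Vss, (A.loc p.1).qRoot w ^ lstar : ℝ) : ℝ) : EReal)
      ≤ A.sizeAt A.adelicLocusTensor ρ := by
  classical
  have hw : ∀ p : A.support, ∃ z ∈ (A.loc p.1).locusBundled,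
      ∀ w : (A.loc p.1).Vss, (A.loc p.1).qRoot w.1 ^ lstar ≤ (A.loc p.1).localSize w.1 ρ (fun j => z j w) :=
    fun p => (A.loc p.1).exists_mem_locusBundled_of_pilot (hZ p)
  choose z hzmem hzle using hw
  let t : (p : A.support) → Fin lstar → T p.1 := fun p => (A.loc p.1).tprodTuple (z p)
  have htmem : t ∈ A.adelicLocusTensor := fun p _ => Set.mem_image_of_mem _ (hzmem p)
  have hprod : (∏ p : A.support, ∏ w ∈ (A.loc p.1).Vss, (A.loc p.1).qRoot w ^ lstar) ≤ A.tupleNorm ρ t := by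
    unfold tupleNorm
    refine Finset.prod_le_prod (fun p _ => Finset.prod_nonneg fun w hw =>
      pow_nonneg ((A.loc p.1).qRoot_pos w hw).le _) fun p _ => ?_
    show (∏ w ∈ (A.loc p.1).Vss, (A.loc p.1).qRoot w ^ lstar) ≤ (A.loc p.1).tupleNormT ρ ((A.loc p.1).tprodTuple (z p))
    rw [(A.loc p.1).tupleNormT_tprodTuple_eq (hx p) (z p), ← Finset.prod_coe_sort (A.loc p.1).Vss]
    exact Finset.prod_le_prod (fun w _ => pow_nonneg ((A.loc p.1).qRoot_pos w.1 w.2).le _) fun w _ => hzle p w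
  exact (EReal.coe_le_coe_iff.2 hprod).trans (A.tupleNorm_le_sizeAt htmem _)

/-- The `(7.2.9)`-form `FundamentalEstimateTensor` from the fixed-`ρ` form at any `ρ ∈ (0,1]` (sharper than the landed
`fundamentalEstimateTensor_of_pilot_of_crossNorm`, which asks the inputs at all `ρ` of an interval). [folklore] -/
theorem fundamentalEstimateTensor_of_sizeAt {ρ : ℝ} (hρ : ρ ∈ Set.Ioc (0 : ℝ) 1)
    (hZ : ∀ p : A.support, (A.loc p.1).PilotLowerBoundAt ρ) (hx : ∀ p : A.support, (A.loc p.1).CrossNormAt ρ) :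
    A.FundamentalEstimateTensor :=
  (A.sizeAt_adelicLocusTensor_ge hZ hx).trans (A.sizeAt_le_size _ hρ)

end PrimeBundlingFamily

end Summit.ABC.IUTFork.Joshi.ATS3

end
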